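import Literature.AnabelianGeometry.SemiGraphs.PSCTwoTripodGraphic
import HarnessLib

/-!
# The two-tripod PSC datum, IV: every set of primes `Σ` (pro-`Σ`, e.g. pro-`l`, two-vertex data)

Mochizuki, *A combinatorial version of the Grothendieck conjecture* [CombGC] §1, Def. 1.1 (ii) p. 6
("of pro-`Σ` PSC-type … the maximal pro-`Σ` quotient"), Prop. 1.2 p. 8, Prop. 1.5 pp. 12–13, Thm. 1.6
(iii) p. 13 [cite: MochizukiCombGC2007, Def 1.1(ii) p.6].  `PSCTwoTripodOrigin/Incidence/Graphic.lean`
inhabit the two-tripod origin by the datum over the FULL profinite completion of `Γ_{0,4}` (`Σ` = all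
primes).  [CombGC] and [IUTchI] §1–2 work pro-`Σ` for an arbitrary nonempty set of primes (pro-`l` in
[IUTchI]); this file records the datum and the rows for EVERY such `Σ`:

* `exists_twoTripodDatum` — over any pro-`Σ` completion `ι : Γ_{0,4} → Π` (`Π` profinite) and the
  basis `(c₁, c₁c₂, c₃)`, the two-tripod datum (`Σ_G = Σ`, `i = 2`, `n = 1`, `r = 4`, genera `0`,
  `Π_{v₁} = closure ι⟨c₁, c₁c₂⟩`, `Π_{v₂} = closure ι⟨c₁c₂, c₃⟩`, `Π_e = closure ι⟨c₁c₂⟩`,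
  `Π_{c_j} = closure ι⟨c_j⟩`, `nodeEnds e = s(v₁, v₂)`) exists;
* `twoTripodRows_of_shape` — at every origin of two-tripod-shaped data: F-0438, F-0459, F-0440, F-0443,
  F-0461 (`CommensurableTerminalityHolds`, `OpenInterDeterminesComponentHolds`, `EdgeLikeIncidenceHolds`,
  `GraphicIffEdgeLikeVerticialHolds`, `UnrVerticialIffHolds`);
* `exists_twoVertexOrigin_holds_of_sigma` — for EVERY nonempty set of primes `Σ` there is a profinite
  `Π` (a pro-`Σ` completion of `Γ_{0,4}`, `exists_isProSigmaCompletion`) and an origin inhabited by a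
  genuine two-vertex datum `G` over `Π` with `G.Sigma = Σ` at which all five rows hold.

Instance forms at genuine anabelian data (free-factor malnormality in pro-`Σ` completions,
Ribes–Zalesskii Thm. 9.1.12 proved in the tree); consistency evidence for the typed schemata, not the
printed theorems for all pointed stable curves.  No side is taken on [IUTchIII] Cor. 3.12.
-/

noncomputable section

namespace Literature.AnabelianGeometry.SemiGraphs

namespace PSCDatum

open scoped Pointwise
open Literature.GroupTheory.CombinatorialGroupTheory
open SemiGraphOfAnabelioids (IsProSigmaCompletion)
open SemiGraphOfAnabelioids.IsProSigmaCompletion (isSigmaInteger_index)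

universe u

/-! ### The datum over an arbitrary pro-`Σ` completion of `Γ_{0,4}` -/

/-- **The two-tripod datum over any pro-`Σ` completion** `ι : Γ_{0,4} → Π` (`Π` profinite, `Σ` a
nonempty set of primes), for the basis `b = (c₁, c₁c₂, c₃)`: vertices `Fin 2`, one node joining them,
cusps `Fin 4` (`c₁, c₂` at `v₁ = 0`, `c₃, c₀` at `v₂ = 1`), `Π_{v₁} = closure ι⟨b₀, b₁⟩`,
`Π_{v₂} = closure ι⟨b₁, b₂⟩`, `Π_e = closure ι⟨b₁⟩`, `Π_{c_j}` the closed cusp inertia groups, genera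
`0`, `Σ_G = Σ` (pro-`Σ`: open normal subgroups of a pro-`Σ` completion have `Σ`-integer index).
[cite: MochizukiCombGC2007, Def 1.1(ii) p.6] -/
theorem exists_twoTripodDatum {P : Type u} [Group P] [TopologicalSpace P] [IsTopologicalGroup P]
    [CompactSpace P] [TotallyDisconnectedSpace P] {Sigma : Set ℕ} (hne : Sigma.Nonempty)
    (hprime : ∀ p ∈ Sigma, p.Prime) (ι : PuncturedSurfaceGroup 0 4 →* P)
    (hι : IsProSigmaCompletion Sigma ι) (b : FreeGroupBasis (Fin 3) (PuncturedSurfaceGroup 0 4))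
    (hb : b 0 = PuncturedSurfaceGroup.c 1 ∧
      b 1 = PuncturedSurfaceGroup.c 1 * PuncturedSurfaceGroup.c 2 ∧ b 2 = PuncturedSurfaceGroup.c 3) :
    ∃ G : PSCDatum P, G.Sigma = Sigma ∧ G.graph.i = 2 ∧ G.graph.n = 1 ∧ G.graph.r = 4 ∧
      (∀ v, G.genus v = 0) ∧
      ∃ (v₁ v₂ : G.graph.V) (f : G.graph.C → Fin 4), v₁ ≠ v₂ ∧ (∀ v, v = v₁ ∨ v = v₂) ∧
        G.vertGp v₁ = ((Subgroup.closure (b '' {0, 1})).map ι).topologicalClosure ∧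
        G.vertGp v₂ = ((Subgroup.closure (b '' {1, 2})).map ι).topologicalClosure ∧
        (∀ e, G.nodeGp e = ((Subgroup.closure (b '' {1})).map ι).topologicalClosure) ∧
        (∀ e e' : G.graph.N, e = e') ∧ Function.Injective f ∧
        (∀ c, G.cuspGp c =
          ((PuncturedSurfaceGroup.cuspInertia (g := 0) (f c)).map ι).topologicalClosure) ∧
        G.genus v₁ < 2 ∧ (∀ e, G.graph.nodeEnds e = s(v₁, v₂)) := by
  obtain ⟨hb0, hb1, hb2⟩ := hb
  have hgen : ∀ (S : Set (Fin 3)) (k : Fin 3), k ∈ S → b k ∈ Subgroup.closure (b '' S) :=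
    fun S k hk => Subgroup.subset_closure ⟨k, hk, rfl⟩
  have hle : ∀ (x : PuncturedSurfaceGroup 0 4) (S : Set (Fin 3)), x ∈ Subgroup.closure (b '' S) →
      ((Subgroup.zpowers x).map ι).topologicalClosure ≤
        ((Subgroup.closure (b '' S)).map ι).topologicalClosure := fun x S hx =>
    Subgroup.topologicalClosure_mono (Subgroup.map_mono ((Subgroup.zpowers_le (g := x)).mpr hx))
  have hc1 : (PuncturedSurfaceGroup.c 1 : PuncturedSurfaceGroup 0 4) ∈
      Subgroup.closure (b '' {0, 1}) := by
    rw [← hb0]; exact hgen _ 0 (by simp)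
  have hc2 : (PuncturedSurfaceGroup.c 2 : PuncturedSurfaceGroup 0 4) ∈
      Subgroup.closure (b '' {0, 1}) := by
    have : (PuncturedSurfaceGroup.c 2 : PuncturedSurfaceGroup 0 4) = (b 0)⁻¹ * b 1 := by
      rw [hb0, hb1, inv_mul_cancel_left]
    rw [this]
    exact Subgroup.mul_mem _ (Subgroup.inv_mem _ (hgen _ 0 (by simp))) (hgen _ 1 (by simp))
  have hc3 : (PuncturedSurfaceGroup.c 3 : PuncturedSurfaceGroup 0 4) ∈
      Subgroup.closure (b '' {1, 2}) := by
    rw [← hb2]; exact hgen _ 2 (by simp)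
  have hc0 : (PuncturedSurfaceGroup.c 0 : PuncturedSurfaceGroup 0 4) ∈
      Subgroup.closure (b '' {1, 2}) := by
    have : (PuncturedSurfaceGroup.c 0 : PuncturedSurfaceGroup 0 4) = (b 1 * b 2)⁻¹ := by
      rw [hb1, hb2, PuncturedSurfaceGroup.c_zero_eq_inv]
    rw [this]
    exact Subgroup.inv_mem _ (Subgroup.mul_mem _ (hgen _ 1 (by simp)) (hgen _ 2 (by simp)))
  have hproSigma : IsProSigma Sigma P := by
    refine ⟨fun U _ p hp hdvd => ?_⟩
    have h := isSigmaInteger_index hι U.toSubgroup U.isOpen'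
    rw [Subgroup.index_eq_card] at h
    exact h.2 p hp hdvd
  let T : PSCDatum P :=
    { Sigma := Sigma
      sigma_prime := hprime
      sigma_nonempty := hne
      graph := { V := Fin 2, N := Unit, C := Fin 4, nodeEnds := fun _ => s(0, 1),
                 cuspEnd := ![1, 0, 0, 1] }
      vertGp := ![((Subgroup.closure (b '' {0, 1})).map ι).topologicalClosure,
        ((Subgroup.closure (b '' {1, 2})).map ι).topologicalClosure]
      nodeGp := fun _ => ((Subgroup.closure (b '' {1})).map ι).topologicalClosure
      cuspGp := fun j => ((PuncturedSurfaceGroup.cuspInertia (g := 0) j).map ι).topologicalClosure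
      genus := fun _ => 0
      isClosed_vertGp := fun v => by
        fin_cases v <;> exact Subgroup.isClosed_topologicalClosure _
      isClosed_nodeGp := fun _ => Subgroup.isClosed_topologicalClosure _
      isClosed_cuspGp := fun _ => Subgroup.isClosed_topologicalClosure _
      nodeGp_le := fun _ => ⟨0, 1, rfl,
        ⟨1, by rw [one_smul, freeFactor_singleton_eq]; exact hle _ _ (hgen _ 1 (by simp))⟩,
        ⟨1, by rw [one_smul, freeFactor_singleton_eq]; exact hle _ _ (hgen _ 1 (by simp))⟩⟩
      cuspGp_le := fun j => ⟨1, by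
        rw [one_smul]
        fin_cases j
        · exact hle _ _ hc0
        · exact hle _ _ hc1
        · exact hle _ _ hc2
        · exact hle _ _ hc3⟩
      proSigma := hproSigma }
  exact ⟨T, rfl, rfl, rfl, rfl, fun _ => rfl, 0, 1, id,
    by change (0 : Fin 2) ≠ 1; decide, fun v => by fin_cases v <;> simp, rfl, rfl, fun _ => rfl,
    fun _ _ => rfl, Function.injective_id, fun _ => rfl, by change (0 : ℕ) < 2; norm_num,
    fun _ => rfl⟩

/-! ### The rows at every origin of two-tripod-shaped data -/

/-- **F-0438 ∧ F-0459 ∧ F-0440 ∧ F-0443 ∧ F-0461 at every origin of two-tripod-shaped data** (any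
carriers, any nonempty sets of primes `Σ`): [CombGC] Prop. 1.2 (ii), Prop. 1.2 (i), Prop. 1.5 (i),
Prop. 1.5 (ii) (by abc-iut-w4-d081's reduction and the branch link) and Thm. 1.6 (iii) (vacuous: not
sturdy). [cite: MochizukiCombGC2007, Prop 1.2 p.8] -/
theorem twoTripodRows_of_shape (Ω : PSCOrigin.{u})
    (hΩ : ∀ ⦃Q : Type u⦄ [Group Q] [TopologicalSpace Q] (G : PSCDatum Q),
      Ω.IsOfPSCType G → ∃ (_ : IsTopologicalGroup Q), CompactSpace Q ∧ T2Space Q ∧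
        TotallyDisconnectedSpace Q ∧
        ∃ (S : Set ℕ) (ι : PuncturedSurfaceGroup 0 4 →* Q)
          (b : FreeGroupBasis (Fin 3) (PuncturedSurfaceGroup 0 4)) (v₁ v₂ : G.graph.V)
          (f : G.graph.C → Fin 4),
          S.Nonempty ∧ (∀ p ∈ S, p.Prime) ∧ IsProSigmaCompletion S ι ∧
          (b 0 = PuncturedSurfaceGroup.c 1 ∧ b 1 = PuncturedSurfaceGroup.c 1 * PuncturedSurfaceGroup.c 2 ∧
            b 2 = PuncturedSurfaceGroup.c 3) ∧
          v₁ ≠ v₂ ∧ (∀ v, v = v₁ ∨ v = v₂) ∧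
          G.vertGp v₁ = ((Subgroup.closure (b '' {0, 1})).map ι).topologicalClosure ∧
          G.vertGp v₂ = ((Subgroup.closure (b '' {1, 2})).map ι).topologicalClosure ∧
          (∀ e, G.nodeGp e = ((Subgroup.closure (b '' {1})).map ι).topologicalClosure) ∧
          (∀ e e' : G.graph.N, e = e') ∧ Function.Injective f ∧
          (∀ c, G.cuspGp c =
            ((PuncturedSurfaceGroup.cuspInertia (g := 0) (f c)).map ι).topologicalClosure) ∧
          G.genus v₁ < 2 ∧ (∀ e, G.graph.nodeEnds e = s(v₁, v₂))) :
    CommensurableTerminalityHolds Ω ∧ OpenInterDeterminesComponentHolds Ω ∧ EdgeLikeIncidenceHolds Ω ∧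
      GraphicIffEdgeLikeVerticialHolds Ω ∧ UnrVerticialIffHolds Ω := by
  obtain ⟨h12ii, h12i⟩ := prop12Holds_of_twoTripod Ω fun Q _ _ _ G hG => by
    obtain ⟨_, h1, h2, h3, S, ι, b, v₁, v₂, f, h⟩ := hΩ G hG
    exact ⟨h1, h2, h3, S, ι, b, v₁, v₂, f, h.1, h.2.1, h.2.2.1, h.2.2.2.1, h.2.2.2.2.1, h.2.2.2.2.2.1,
      h.2.2.2.2.2.2.1, h.2.2.2.2.2.2.2.1, h.2.2.2.2.2.2.2.2.1, h.2.2.2.2.2.2.2.2.2.1,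
      h.2.2.2.2.2.2.2.2.2.2.1, h.2.2.2.2.2.2.2.2.2.2.2.1, h.2.2.2.2.2.2.2.2.2.2.2.2.1⟩
  have h15 : EdgeLikeIncidenceHolds Ω := edgeLikeIncidenceHolds_of_twoTripod Ω fun Q _ _ G hG => by
    obtain ⟨hTG, h1, h2, h3, S, ι, b, v₁, v₂, f, h⟩ := hΩ G hG
    exact ⟨hTG, h1, h2, h3, S, ι, b, v₁, v₂, f, h.1, h.2.1, h.2.2.1, h.2.2.2.1, h.2.2.2.2.1,
      h.2.2.2.2.2.1, h.2.2.2.2.2.2.1, h.2.2.2.2.2.2.2.1, h.2.2.2.2.2.2.2.2.1, h.2.2.2.2.2.2.2.2.2.1,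
      h.2.2.2.2.2.2.2.2.2.2.1, h.2.2.2.2.2.2.2.2.2.2.2.1, h.2.2.2.2.2.2.2.2.2.2.2.2.1⟩
  have hbr : ∀ ⦃Q : Type u⦄ [Group Q] [TopologicalSpace Q] [IsTopologicalGroup Q] (G : PSCDatum Q),
      Ω.IsOfPSCType G → ∀ e : G.graph.N, ∃ (v₁ v₂ : G.graph.V) (γ₁ γ₂ : ConjAct Q),
        G.graph.nodeEnds e = s(v₁, v₂) ∧ γ₁ • G.nodeGp e ≤ G.vertGp v₁ ∧
          γ₂ • G.nodeGp e ≤ G.vertGp v₂ ∧ γ₁⁻¹ • G.vertGp v₁ ≠ γ₂⁻¹ • G.vertGp v₂ := by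
    intro Q _ _ _ G hG e
    obtain ⟨_, _, _, _, S, ι, b, v₁, v₂, f, hne, hprime, hι, -, -, -, hV₁, hV₂, hN, -, -, -, -,
      hends⟩ := hΩ G hG
    have hp : ∃ p ∈ S, p.Prime := by
      obtain ⟨p, hp⟩ := hne
      exact ⟨p, hp, hprime p hp⟩
    refine ⟨v₁, v₂, 1, 1, hends e, ?_, ?_, ?_⟩
    · rw [one_smul, hN, hV₁, freeFactor_singleton_eq]
      exact Subgroup.topologicalClosure_mono (Subgroup.map_mono
        ((Subgroup.zpowers_le (g := b 1)).mpr (Subgroup.subset_closure ⟨1, by simp, rfl⟩)))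
    · rw [one_smul, hN, hV₂, freeFactor_singleton_eq]
      exact Subgroup.topologicalClosure_mono (Subgroup.map_mono
        ((Subgroup.zpowers_le (g := b 1)).mpr (Subgroup.subset_closure ⟨1, by simp, rfl⟩)))
    · rw [inv_one, one_smul, one_smul, hV₁, hV₂]
      exact twoTripod_vertGp_ne hι hp b
  have h16iii : UnrVerticialIffHolds Ω := by
    intro Q _ _ _ Q' _ _ _ G H β hG _ hGst _
    obtain ⟨_, _, _, _, S, ι, b, v₁, v₂, f, -, -, -, -, -, -, -, -, -, -, -, -, hg, -⟩ := hΩ G hG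
    exact absurd (hGst v₁) (not_le.mpr hg)
  exact ⟨h12ii, h12i, h15, graphicIffEdgeLikeVerticialHolds_of_incidence Ω h12i h15 hbr, h16iii⟩

/-! ### Every nonempty set of primes `Σ` -/

/-- **For every nonempty set of primes `Σ` (e.g. `Σ = {l}`: pro-`l`), the rows F-0438, F-0459, F-0440,
F-0443, F-0461 HOLD at an origin inhabited by a GENUINE pro-`Σ` two-vertex datum**: over a pro-`Σ`
completion `Π` of `Γ_{0,4}` (`exists_isProSigmaCompletion`), the two-tripod datum with `Σ_G = Σ`,
`i = 2`, `n = 1`, `r = 4`, genera `0`. [cite: MochizukiCombGC2007, Prop 1.2 p.8] -/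
theorem exists_twoVertexOrigin_holds_of_sigma (Sigma : Set ℕ) (hne : Sigma.Nonempty)
    (hprime : ∀ p ∈ Sigma, p.Prime) :
    ∃ (Q : ProfiniteGrp.{0}) (Ω : PSCOrigin.{0}),
      (∃ G : PSCDatum Q, Ω.IsOfPSCType G ∧ G.Sigma = Sigma ∧ G.graph.i = 2 ∧ G.graph.n = 1 ∧
        G.graph.r = 4 ∧ (∀ v, G.genus v = 0)) ∧
      CommensurableTerminalityHolds Ω ∧ OpenInterDeterminesComponentHolds Ω ∧ EdgeLikeIncidenceHolds Ω ∧
        GraphicIffEdgeLikeVerticialHolds Ω ∧ UnrVerticialIffHolds Ω := by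
  let Ω : PSCOrigin.{0} :=
    ⟨fun {Q} _ _ G => ∃ (_ : IsTopologicalGroup Q), CompactSpace Q ∧ T2Space Q ∧
      TotallyDisconnectedSpace Q ∧
        ∃ (S : Set ℕ) (ι : PuncturedSurfaceGroup 0 4 →* Q)
          (b : FreeGroupBasis (Fin 3) (PuncturedSurfaceGroup 0 4)) (v₁ v₂ : G.graph.V)
          (f : G.graph.C → Fin 4),
          S.Nonempty ∧ (∀ p ∈ S, p.Prime) ∧ IsProSigmaCompletion S ι ∧
          (b 0 = PuncturedSurfaceGroup.c 1 ∧ b 1 = PuncturedSurfaceGroup.c 1 * PuncturedSurfaceGroup.c 2 ∧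
            b 2 = PuncturedSurfaceGroup.c 3) ∧
          v₁ ≠ v₂ ∧ (∀ v, v = v₁ ∨ v = v₂) ∧
          G.vertGp v₁ = ((Subgroup.closure (b '' {0, 1})).map ι).topologicalClosure ∧
          G.vertGp v₂ = ((Subgroup.closure (b '' {1, 2})).map ι).topologicalClosure ∧
          (∀ e, G.nodeGp e = ((Subgroup.closure (b '' {1})).map ι).topologicalClosure) ∧
          (∀ e e' : G.graph.N, e = e') ∧ Function.Injective f ∧
          (∀ c, G.cuspGp c =
            ((PuncturedSurfaceGroup.cuspInertia (g := 0) (f c)).map ι).topologicalClosure) ∧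
          G.genus v₁ < 2 ∧ (∀ e, G.graph.nodeEnds e = s(v₁, v₂))⟩
  obtain ⟨Q, ι, hι⟩ :=
    SemiGraphOfAnabelioids.IsProSigmaCompletion.exists_isProSigmaCompletion
      (PuncturedSurfaceGroup 0 4) Sigma
  obtain ⟨b, hb⟩ := PuncturedSurfaceGroup.exists_freeGroupBasis_node
  obtain ⟨G, hSig, hi, hn, hr, hg0, v₁, v₂, f, hv, hV, hV₁, hV₂, hN, hNs, hf, hC, hg, hends⟩ :=
    exists_twoTripodDatum hne hprime ι hι b hb
  have hG : Ω.IsOfPSCType G :=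
    ⟨inferInstance, inferInstance, inferInstance, inferInstance, Sigma, ι, b, v₁, v₂, f, hne, hprime,
      hι, hb, hv, hV, hV₁, hV₂, hN, hNs, hf, hC, hg, hends⟩
  exact ⟨Q, Ω, ⟨G, hG, hSig, hi, hn, hr, hg0⟩, twoTripodRows_of_shape Ω fun Q _ _ G hG => hG⟩

end PSCDatum

end Literature.AnabelianGeometry.SemiGraphs

end
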